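import Mathlib
import HarnessLib
import Literature.Computability.AlgebraicComplexity.DegenerationSpectralMonotone
import Summits.MatrixMultiplication.MatrixMultiplication.Theorems.CwSquareDegeneratesToMM223
import Summits.MatrixMultiplication.MatrixMultiplication.Theorems.OutsiderSandwichSegreTransport

/-!
# OutsiderSandwich — `⟨2,2,2⟩ ⊕ ⟨2⟩ ⊴₄ cw₂ ⊠ cw₂`: the `(2,2)` cell is larger in the degeneration order
(decomp-mm lens 4 «minimal-counterexample / extremal reduction», gen 42, kernel K42-d; THESES-FREE;
definitions = the certificate tables only, as in `CwSquareDegeneratesToMM223` / `OutsiderSandwichMMPlusPoint`)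

Host: the Kronecker square `cw₂ ⊠ cw₂` of the little Coppersmith–Winograd tensor (format `9³`, `36`
terms; `≅ perm₃` over `ℂ`).  In kernel before this file, over `ℂ` and in the RESTRICTION order:
`⟨6⟩ ≤ cw₂^{⊠2}`, `⟨7⟩ ≰` (`Q = 6`, K39), `⟨2,2,2⟩ ⊕ ⟨1⟩ ≤` (K42-b, `OutsiderSandwichMMPlusPoint`),
`2·⟨2,2,2⟩ ≰` (K42-a, `OutsiderSandwichSegreTransport`); `⟨2,2,2⟩ ⊕ ⟨2⟩ ≤ ?` open (Levenberg–Marquardt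
numerics: residual `→ 0` only with diverging factor norms).  In the DEGENERATION order (BCS (15.19),
the tree's `IsApproxRestriction h` / `AlgDegeneratesTo`): `⟨2,2,3⟩ ⊴₁ cw₂^{⊠2}` (`CwSquareDegeneratesToMM223`).

**This file proves, over every commutative ring `R`:**

* `isApproxRestriction` — explicit MONOMIAL matrices `A(ε), B(ε), C(ε)` (each host variable goes to at
  most one target variable with a sign and a power `ε^w`, `0 ≤ w ≤ 4`; tables `dT?/dS?/dW?`) with
  `(A(ε) ⊗ B(ε) ⊗ C(ε))·(cw₂ ⊠ cw₂) = ε⁴·(⟨2,2,2⟩ ⊕ ⟨2⟩) + O(ε⁵)`: a degeneration of ORDER FOUR.  Of the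
  `36` host terms, `10` carry the target at order `ε⁴` (the `8` trace monomials and the two points),
  `18` are pushed to orders `5–8`, `8` are killed; no term sits below order `4`.  Found by simulated
  annealing over signed monomial maps with integer weights (`degen.c`, seed 73, `< 60 s`), checked
  independently (`verify_degen.py`) and here by `decide` over `ℤ` (`cert`: the five coefficient layers
  `ε⁰…ε⁴` of all `216` target entries).
* `mmPlusTwo_deg_cwTwoPow_two` — `⟨2,2,2⟩ ⊕ ⟨2⟩ ⊴ cw₂^{⊠2}` for the tree's `kroneckerPow (cwTensor R 2) 2`;
  instance over `ℂ`.
* `cell_two_two_orders_differ` (over `ℂ`) — side by side: `2·⟨2,2,2⟩ ≰ cw₂^{⊠2}` (restriction, K42-a) while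
  `⟨2,2,2⟩ ⊕ ⟨2⟩ ⊴ cw₂^{⊠2}` (degeneration, this file).

Census reading (decomp-mm lens 4; instrument of `LaserTangency`, stmt-32268, whose tables are
RESTRICTION tables `⟨B⟩ ⊠ ⟨m,m,m⟩ ≤ cw₂^{⊠N}`): at `N = 2` the best certified packings of `{⟨2,2,2⟩, ⟨1⟩}`-sums
are `⟨6⟩` and `⟨2,2,2⟩ ⊕ ⟨1⟩` by restriction, but `⟨2,2,2⟩ ⊕ ⟨2⟩` by degeneration — one more free point,
bought with `ε⁴`.  Whether `⟨2,2,2⟩ ⊕ ⟨2⟩` is an honest restriction, and whether `⟨7⟩ ⊴ cw₂^{⊠2}`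
(border subrank `7` against subrank `6`), remain open; the same annealer finds no monomial degeneration
`2·⟨2,2,2⟩ ⊴_h cw₂^{⊠2}` for `h ≤ 6` (best defect `5`), consistent with K42-a.

References: [cite: BurgisserClausenShokrollahi1997, (15.19), (15.25), §15.6];
[cite: CoppersmithWinograd1990, §6–7]; [cite: ConnerGesmundoLandsbergVentura2022, Lemma 2.10];
[cite: Blaser2013, §6].
-/

set_option linter.dupNamespace false

namespace Summit.MatrixMultiplication.MatrixMultiplication.Theorems.OutsiderSandwichMMPlusTwoDegeneration

open scoped BigOperators Polynomial
open Literature.Computability.AlgebraicComplexity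
open Summit.MatrixMultiplication.MatrixMultiplication.Theorems.CwSquareDegeneratesToMM223
  (intCast_cwSq intCast_matMulTensor kroneckerPow_two_restrictsTo)

/-! ## The certificate (host coordinate `(a₁,a₂) ∈ Fin 3 × Fin 3`; target codes `Fin 7`, `6` = dropped) -/

/-- Codes of the target slots 2 and 3: `⟨2,2,2⟩`-index `(u,v) ↦ 2u+v ∈ {0,…,3}`, the points
`w ↦ 4 + w` (`6` = "dropped host coordinate"). [new] -/
def code : (Fin 2 × Fin 2) ⊕ Fin 2 → Fin 7
  | Sum.inl p => ⟨2 * p.1.val + p.2.val, by have := p.1.isLt; have := p.2.isLt; omega⟩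
  | Sum.inr w => ⟨4 + w.val, by have := w.isLt; omega⟩

/-- Codes of target slot 1: the search wrote `⟨2,2,2⟩` as `Σ x_{ij} y_{jl} z_{li}`; in the tree's index
order `(i,l), (i,j), (j,l)` of `matMulTensor` the first index pair is read transposed, `(u,v) ↦ 2v+u`. [new] -/
def codeA : (Fin 2 × Fin 2) ⊕ Fin 2 → Fin 7
  | Sum.inl p => ⟨2 * p.2.val + p.1.val, by have := p.1.isLt; have := p.2.isLt; omega⟩
  | Sum.inr w => ⟨4 + w.val, by have := w.isLt; omega⟩

/-- slot-1 map: host coordinate ↦ target code. [new] -/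
def dTA : Fin 3 → Fin 3 → Fin 7 := ![![4, 1, 3], ![6, 0, 3], ![3, 5, 2]]
/-- slot-1 signs. [new] -/
def dSA : Fin 3 → Fin 3 → ℤ := ![![-1, -1, 1], ![0, -1, 1], ![1, -1, 1]]
/-- slot-1 weights (powers of `ε`). [new] -/
def dWA : Fin 3 → Fin 3 → ℕ := ![![3, 0, 4], ![0, 1, 3], ![2, 1, 2]]
/-- slot-2 map. [new] -/
def dTB : Fin 3 → Fin 3 → Fin 7 := ![![1, 0, 3], ![3, 2, 4], ![0, 5, 2]]
/-- slot-2 signs. [new] -/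
def dSB : Fin 3 → Fin 3 → ℤ := ![![-1, -1, -1], ![-1, -1, -1], ![-1, 1, -1]]
/-- slot-2 weights. [new] -/
def dWB : Fin 3 → Fin 3 → ℕ := ![![2, 0, 2], ![3, 1, 1], ![2, 0, 2]]
/-- slot-3 map. [new] -/
def dTC : Fin 3 → Fin 3 → Fin 7 := ![![5, 4, 1], ![0, 2, 4], ![6, 5, 3]]
/-- slot-3 signs. [new] -/
def dSC : Fin 3 → Fin 3 → ℤ := ![![-1, 1, -1], ![1, 1, 1], ![0, -1, -1]]
/-- slot-3 weights. [new] -/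
def dWC : Fin 3 → Fin 3 → ℕ := ![![3, 3, 0], ![3, 1, 0], ![0, 4, 0]]

variable (R : Type) [CommRing R]

/-- the polynomial matrix `A(ε)`: entry `± ε^{w}` at `(codeA⁻¹ (dTA a), a)`, else `0`. [new] -/
noncomputable def mA (x : (Fin 2 × Fin 2) ⊕ Fin 2) (a : Fin 3 × Fin 3) : R[X] :=
  if dTA a.1 a.2 = codeA x then Polynomial.C ((dSA a.1 a.2 : ℤ) : R) * Polynomial.X ^ dWA a.1 a.2 else 0
/-- the polynomial matrix `B(ε)`. [new] -/
noncomputable def mB (y : (Fin 2 × Fin 2) ⊕ Fin 2) (b : Fin 3 × Fin 3) : R[X] :=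
  if dTB b.1 b.2 = code y then Polynomial.C ((dSB b.1 b.2 : ℤ) : R) * Polynomial.X ^ dWB b.1 b.2 else 0
/-- the polynomial matrix `C(ε)`. [new] -/
noncomputable def mC (z : (Fin 2 × Fin 2) ⊕ Fin 2) (c : Fin 3 × Fin 3) : R[X] :=
  if dTC c.1 c.2 = code z then Polynomial.C ((dSC c.1 c.2 : ℤ) : R) * Polynomial.X ^ dWC c.1 c.2 else 0

/-- the `ε^n`-coefficient contributed by the host triple `(a,b,c)` to the target entry `(x,y,z)`,
over `ℤ`. [new] -/
def fT (n : ℕ) (x y z : (Fin 2 × Fin 2) ⊕ Fin 2) (a b c : Fin 3 × Fin 3) : ℤ :=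
  if dTA a.1 a.2 = codeA x ∧ dTB b.1 b.2 = code y ∧ dTC c.1 c.2 = code z ∧
      n = dWA a.1 a.2 + dWB b.1 b.2 + dWC c.1 c.2 then
    dSA a.1 a.2 * dSB b.1 b.2 * dSC c.1 c.2 * kroneckerTensor (cwTensor ℤ 2) (cwTensor ℤ 2) a b c
  else 0

/-- the same coefficient summed over the host, with the slot tests hoisted (fast to `decide`). [new] -/
def cS (n : ℕ) (x y z : (Fin 2 × Fin 2) ⊕ Fin 2) : ℤ :=
  ∑ a : Fin 3 × Fin 3, if dTA a.1 a.2 = codeA x then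
    (∑ b : Fin 3 × Fin 3, if dTB b.1 b.2 = code y then ∑ c : Fin 3 × Fin 3, fT n x y z a b c else 0)
  else 0

/-! ## Bookkeeping -/

/-- coefficient of a product of three optional monomials and a constant. [folklore] -/
theorem coeff_mono_term (p q r : Prop) [Decidable p] [Decidable q] [Decidable r] (x y z u : R)
    (i j k n : ℕ) :
    ((if p then Polynomial.C x * Polynomial.X ^ i else 0) *
        (if q then Polynomial.C y * Polynomial.X ^ j else 0) *
        (if r then Polynomial.C z * Polynomial.X ^ k else 0) * Polynomial.C u).coeff n =
      if p ∧ q ∧ r ∧ n = i + j + k then x * y * z * u else 0 := by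
  by_cases hp : p <;> by_cases hq : q <;> by_cases hr : r <;> simp only [hp, hq, hr, if_true,
    if_false, zero_mul, mul_zero, Polynomial.coeff_zero, true_and, false_and, and_false]
  have e : Polynomial.C x * Polynomial.X ^ i * (Polynomial.C y * Polynomial.X ^ j) *
      (Polynomial.C z * Polynomial.X ^ k) * Polynomial.C u =
      Polynomial.C (x * y * z * u) * Polynomial.X ^ (i + j + k) := by
    simp only [map_mul, pow_add]; ring
  rw [e, Polynomial.coeff_C_mul_X_pow]

/-- the `ε^n`-coefficient of one summand is the cast of `fT`. [new] -/
theorem coeff_term (n : ℕ) (x y z : (Fin 2 × Fin 2) ⊕ Fin 2) (a b c : Fin 3 × Fin 3) :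
    (mA R x a * mB R y b * mC R z c *
        Polynomial.C (kroneckerTensor (cwTensor R 2) (cwTensor R 2) a b c)).coeff n =
      ((fT n x y z a b c : ℤ) : R) := by
  rw [mA, mB, mC, coeff_mono_term, fT]
  split_ifs with h
  · push_cast; rw [intCast_cwSq]
  · simp

/-- flat triple sum `=` hoisted sum. [new] -/
theorem flat_eq (n : ℕ) (x y z : (Fin 2 × Fin 2) ⊕ Fin 2) :
    ∑ a : Fin 3 × Fin 3, ∑ b : Fin 3 × Fin 3, ∑ c : Fin 3 × Fin 3, fT n x y z a b c = cS n x y z := by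
  unfold cS
  refine Finset.sum_congr rfl fun a _ => ?_
  split_ifs with ha
  · refine Finset.sum_congr rfl fun b _ => ?_
    split_ifs with hb
    · rfl
    · exact Finset.sum_eq_zero fun c _ => by simp [fT, hb]
  · exact Finset.sum_eq_zero fun b _ => Finset.sum_eq_zero fun c _ => by simp [fT, ha]

/-- cast `ℤ → R` of the target `⟨2,2,2⟩ ⊕ ⟨2⟩`. [folklore] -/
theorem intCast_target (x y z : (Fin 2 × Fin 2) ⊕ Fin 2) :
    ((directSumTensor (matMulTensor ℤ 2 2 2) (unitTensor ℤ 2) x y z : ℤ) : R) =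
      directSumTensor (matMulTensor R 2 2 2) (unitTensor R 2) x y z := by
  rcases x with x | x <;> rcases y with y | y <;> rcases z with z | z <;>
    simp [directSumTensor, intCast_matMulTensor, unitTensor]

set_option maxRecDepth 8000 in
set_option maxHeartbeats 2000000 in
/-- **The certificate over `ℤ`**: the `ε⁰ … ε³` layers vanish and the `ε⁴` layer is `⟨2,2,2⟩ ⊕ ⟨2⟩`,
for all `216` target entries, by `decide`. [new] -/
theorem cert : ∀ (n : Fin 5) (x y z : (Fin 2 × Fin 2) ⊕ Fin 2),
    cS n x y z = if (n : ℕ) = 4 then directSumTensor (matMulTensor ℤ 2 2 2) (unitTensor ℤ 2) x y z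
      else 0 := by
  intro n x
  fin_cases n <;> rcases x with ⟨u, v⟩ | w <;> (try fin_cases u) <;> (try fin_cases v) <;>
    (try fin_cases w) <;> decide

/-! ## The degeneration -/

/-- **`(A(ε) ⊗ B(ε) ⊗ C(ε))·(cw₂ ⊠ cw₂) = ε⁴·(⟨2,2,2⟩ ⊕ ⟨2⟩) + O(ε⁵)`** — a degeneration of order `4`
in the sense of BCS (15.19), over every commutative ring. [new] -/
theorem isApproxRestriction :
    IsApproxRestriction 4 (kroneckerTensor (cwTensor R 2) (cwTensor R 2))
      (directSumTensor (matMulTensor R 2 2 2) (unitTensor R 2)) (mA R) (mB R) (mC R) := by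
  intro x y z n hn
  simp only [Polynomial.finsetSum_coeff, coeff_term]
  have hsum : (∑ a : Fin 3 × Fin 3, ∑ b : Fin 3 × Fin 3, ∑ c : Fin 3 × Fin 3,
      ((fT n x y z a b c : ℤ) : R)) = ((cS n x y z : ℤ) : R) := by
    rw [← flat_eq]; push_cast; rfl
  have hc := cert ⟨n, by omega⟩ x y z
  rw [hsum, hc]
  split_ifs with h4
  · exact intCast_target R x y z
  · simp

/-- **`⟨2,2,2⟩ ⊕ ⟨2⟩ ⊴ cw₂ ⊠ cw₂`**. [new] -/
theorem algDegeneratesTo_cwSq :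
    AlgDegeneratesTo (kroneckerTensor (cwTensor R 2) (cwTensor R 2))
      (directSumTensor (matMulTensor R 2 2 2) (unitTensor R 2)) :=
  ⟨4, _, _, _, isApproxRestriction R⟩

/-- **`⟨2,2,2⟩ ⊕ ⟨2⟩ ⊴ cw₂^{⊠2}`** (`kroneckerPow (cwTensor R 2) 2`), over any commutative ring `R`. [new] -/
theorem mmPlusTwo_deg_cwTwoPow_two :
    AlgDegeneratesTo (kroneckerPow (cwTensor R 2) 2)
      (directSumTensor (matMulTensor R 2 2 2) (unitTensor R 2)) :=
  (kroneckerPow_two_restrictsTo R _).algDegeneratesTo_trans (algDegeneratesTo_cwSq R)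

/-- `⟨2,2,2⟩ ⊕ ⟨2⟩ ⊴ cw₂^{⊠2}` over `ℂ`. [new] -/
theorem mmPlusTwo_deg_cwTwoPow_two_complex :
    AlgDegeneratesTo (kroneckerPow (cwTensor ℂ 2) 2)
      (directSumTensor (matMulTensor ℂ 2 2 2) (unitTensor ℂ 2)) :=
  mmPlusTwo_deg_cwTwoPow_two ℂ

/-- **The `(2,2)` cell in the two orders** (over `ℂ`): two copies of `⟨2,2,2⟩` are NOT a restriction of
`cw₂^{⊠2}` (K42-a), while `⟨2,2,2⟩` plus two free points IS a degeneration of it (K42-d). [new] -/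
theorem cell_two_two_orders_differ :
    ¬ TensorRestrictsTo (kroneckerPow (cwTensor ℂ 2) 2)
        (kroneckerTensor (unitTensor ℂ 2) (matMulTensor ℂ 2 2 2)) ∧
      AlgDegeneratesTo (kroneckerPow (cwTensor ℂ 2) 2)
        (directSumTensor (matMulTensor ℂ 2 2 2) (unitTensor ℂ 2)) :=
  ⟨OutsiderSandwichSegreTransport.not_pack_two_two_le_cwPow_two, mmPlusTwo_deg_cwTwoPow_two_complex⟩

end Summit.MatrixMultiplication.MatrixMultiplication.Theorems.OutsiderSandwichMMPlusTwoDegeneration
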